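import Mathlib
import HarnessLib

/-!
# The dual coalgebra of a finite free algebra: the comultiplication `μ^*` on `B^* = Hom_R(B, R)`,
# its coassociativity, the counit `f ↦ f 1`, and cocommutativity
(Tate, *Finite flat group schemes* (in Cornell–Silverman–Stevens 1997), §(3.8) «The dual Hopf algebra and Cartier
duality», pp. 144–146: «if `A` is finite and flat [free] over `R`, the dual module `A′ = Hom_R(A, R)` … the transposes
`m′ : A′ → (A ⊗ A)′ = A′ ⊗ A′`, `e′`, … make `A′` a cocommutative Hopf algebra»; Montgomery, *Hopf algebras and their actions
on rings*, CBMS 82 (1993), 1.3.5 ∕ 9.1.1–9.1.3 (the finite dual `A^*` of a finite-dimensional algebra is a coalgebra with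
`Δ = m^*`, `ε = u^*`))

Topic `RingTheory/HopfAlgebra`; namespace `Literature.RingTheory.HopfAlgebra`.  THEOREMS ONLY (no definition, no instance,
no notation, no named fact, no `sorry`); Mathlib-only.  Cell `pub/hodgecm-mathlib` (D-0151), FLOOR 0, programme F0P5a (crux item
stmt-HodgeConjecture-24832; PLAN v4.1 §2 row H-CD «Cartier duality at `p`», KF8; piece **CD1-thm, file 1 of 2** = the COALGEBRA
half of the dual Hopf algebra, stated on Mathlib's convolution carrier `WithConv (Module.Dual R B)` in the hypothesis style of
★ `FiniteDualPoints` (CD2-pts) so that a later bundled `Coalgebra ∕ Bialgebra ∕ HopfAlgebra` definition instantiates every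
statement by `rfl`∕`simp`) — road- and floor-independent commutative algebra; changes no count.

SETTING.  `R` a commutative semiring, `B` an `R`-algebra, `W := WithConv (Module.Dual R B)` (Mathlib's carrier of the
convolution algebra; here only its `R`-module structure is used).  All structure maps are HYPOTHESES characterised by
equations: the evaluation pairing `ev : W ⊗[R] W →ₗ[R] Dual R (B ⊗[R] B)`, `hev : ev (g ⊗ h) (x ⊗ y) = g x * h y` (§1: exists,
unique, BIJECTIVE when `B` is finite free — `TensorProduct.dualDistribEquiv`); the dual comultiplication `δ : W →ₗ[R] W ⊗[R] W`,
`hδ : ev (δ f) (x ⊗ y) = f (x * y)` («`δ = μ^*`», §2: exists, unique); the triple evaluation `ev₃`, `hev₃ : ev₃ (g ⊗ t) (x ⊗ w)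
= g x * ev t w` (§3, the test space for coassociativity); the dual counit `ε : W →ₗ[R] R`, `hε : ε f = f 1` («`ε = η^*`», §4).
RESULTS = the three `Coalgebra` structure fields of Mathlib VERBATIM on the carrier `W`, plus `IsCocomm`:
§3 **`dualComul_coassoc`** `: TensorProduct.assoc R W W W ∘ₗ δ.rTensor W ∘ₗ δ = δ.lTensor W ∘ₗ δ`; §4
**`rTensor_dualCounit_comp_dualComul`** `: ε.rTensor W ∘ₗ δ = TensorProduct.mk R R W 1`, **`lTensor_dualCounit_comp_dualComul`**
`: ε.lTensor W ∘ₗ δ = (TensorProduct.mk R W R).flip 1`; §5 **`comm_comp_dualComul`** `: comm ∘ₗ δ = δ` for COMMUTATIVE `B`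
(all for finite free `B`).  File 2 (`FiniteDualBialgebraLaws`) adds the `Bialgebra`∕`HopfAlgebra` fields for the convolution
product.  NOT here: the bundled instances (DEF lane), the bidual `B ≃ B^**`, quotients∕sub-objects under duality, schemes.

HC_CM is proved only modulo the 7 printed citations until rung 0 closes; this file is generic algebra and changes no count.

## References
* [Tate1997FiniteFlatGroupSchemes] J. Tate, *Finite flat group schemes*, in: Modular Forms and Fermat's Last Theorem (1997), §(3.8)
  pp. 144–146.
* [Montgomery1993Hopf] S. Montgomery, *Hopf algebras and their actions on rings*, CBMS 82 (1993), 1.3.5, 9.1.1–9.1.3.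
-/

set_option autoImplicit false

noncomputable section

open TensorProduct Module WithConv

namespace Literature.RingTheory.HopfAlgebra

universe u v

/-! ## §1 The evaluation pairing `B^* ⊗ B^* → (B ⊗ B)^*` -/

section EvalTwo

variable {R : Type u} [CommSemiring R] {B : Type v} [AddCommMonoid B] [Module R B]

variable (R B) in
/-- **existence of the evaluation pairing** `ev : B^* ⊗ B^* → (B ⊗ B)^*`, `ev (g ⊗ h) (x ⊗ y) = g x * h y`
(it is `TensorProduct.dualDistrib` transported along `WithConv.ofConv`).
[cite: Tate1997FiniteFlatGroupSchemes, §(3.8) p. 145] -/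
theorem exists_evalTwo :
    ∃ ev : WithConv (Module.Dual R B) ⊗[R] WithConv (Module.Dual R B) →ₗ[R] Module.Dual R (B ⊗[R] B),
      ∀ (g h : WithConv (Module.Dual R B)) (x y : B), ev (g ⊗ₜ h) (x ⊗ₜ y) = g x * h y :=
  ⟨TensorProduct.dualDistrib R B B ∘ₗ
      TensorProduct.map (WithConv.linearEquiv R (Module.Dual R B)).toLinearMap
        (WithConv.linearEquiv R (Module.Dual R B)).toLinearMap,
    fun g h x y => by simp⟩

variable {ev ev' : WithConv (Module.Dual R B) ⊗[R] WithConv (Module.Dual R B) →ₗ[R] Module.Dual R (B ⊗[R] B)}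

/-- the evaluation pairing is unique. [cite: Tate1997FiniteFlatGroupSchemes, §(3.8) p. 145] -/
theorem evalTwo_unique
    (hev : ∀ (g h : WithConv (Module.Dual R B)) (x y : B), ev (g ⊗ₜ h) (x ⊗ₜ y) = g x * h y)
    (hev' : ∀ (g h : WithConv (Module.Dual R B)) (x y : B), ev' (g ⊗ₜ h) (x ⊗ₜ y) = g x * h y) :
    ev = ev' :=
  TensorProduct.ext' fun g h => TensorProduct.ext' fun x y => by rw [hev, hev']

/-- the evaluation pairing is `TensorProduct.dualDistrib R B B` transported along `WithConv.ofConv`.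
[cite: Tate1997FiniteFlatGroupSchemes, §(3.8) p. 145] -/
theorem evalTwo_eq
    (hev : ∀ (g h : WithConv (Module.Dual R B)) (x y : B), ev (g ⊗ₜ h) (x ⊗ₜ y) = g x * h y) :
    ev = TensorProduct.dualDistrib R B B ∘ₗ
      TensorProduct.map (WithConv.linearEquiv R (Module.Dual R B)).toLinearMap
        (WithConv.linearEquiv R (Module.Dual R B)).toLinearMap :=
  evalTwo_unique hev fun g h x y => by simp

/-- **the evaluation pairing is bijective when `B` is finite free** (`B^* ⊗ B^* = (B ⊗ B)^*`, Mathlib's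
`TensorProduct.dualDistribEquiv`). [cite: Tate1997FiniteFlatGroupSchemes, §(3.8) p. 145] -/
theorem evalTwo_bijective [Module.Free R B] [Module.Finite R B]
    (hev : ∀ (g h : WithConv (Module.Dual R B)) (x y : B), ev (g ⊗ₜ h) (x ⊗ₜ y) = g x * h y) :
    Function.Bijective ev := by
  let e : WithConv (Module.Dual R B) ⊗[R] WithConv (Module.Dual R B) ≃ₗ[R] Module.Dual R (B ⊗[R] B) :=
    (TensorProduct.congr (WithConv.linearEquiv R (Module.Dual R B))
      (WithConv.linearEquiv R (Module.Dual R B))).trans (TensorProduct.dualDistribEquiv R B B)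
  have he : ev = e.toLinearMap := by
    refine evalTwo_unique hev fun g h x y => ?_
    change TensorProduct.dualDistribEquiv R B B
      (TensorProduct.congr (WithConv.linearEquiv R (Module.Dual R B))
        (WithConv.linearEquiv R (Module.Dual R B)) (g ⊗ₜ h)) (x ⊗ₜ y) = g x * h y
    rw [TensorProduct.congr_tmul]
    exact TensorProduct.dualDistrib_apply (ofConv g) (ofConv h) x y
  rw [he]
  exact e.bijective

/-- the evaluation pairing is injective when `B` is finite free: an element of `B^* ⊗ B^*` is determined by its values
`ev t (x ⊗ y)`. [cite: Tate1997FiniteFlatGroupSchemes, §(3.8) p. 145] -/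
theorem eq_of_evalTwo_eq [Module.Free R B] [Module.Finite R B]
    (hev : ∀ (g h : WithConv (Module.Dual R B)) (x y : B), ev (g ⊗ₜ h) (x ⊗ₜ y) = g x * h y)
    {s t : WithConv (Module.Dual R B) ⊗[R] WithConv (Module.Dual R B)}
    (h : ∀ x y : B, ev s (x ⊗ₜ y) = ev t (x ⊗ₜ y)) : s = t :=
  (evalTwo_bijective hev).1 (TensorProduct.ext' h)

/-- swapping the factors of `B^* ⊗ B^*` swaps the arguments of the evaluation.
[cite: Montgomery1993Hopf, 9.1.1] -/
theorem evalTwo_comm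
    (hev : ∀ (g h : WithConv (Module.Dual R B)) (x y : B), ev (g ⊗ₜ h) (x ⊗ₜ y) = g x * h y)
    (t : WithConv (Module.Dual R B) ⊗[R] WithConv (Module.Dual R B)) (x y : B) :
    ev (TensorProduct.comm R _ _ t) (x ⊗ₜ y) = ev t (y ⊗ₜ x) := by
  induction t using TensorProduct.induction_on with
  | zero => simp
  | tmul g h => rw [TensorProduct.comm_tmul, hev, hev, mul_comm]
  | add s t hs ht => rw [map_add, map_add, LinearMap.add_apply, hs, ht, map_add, LinearMap.add_apply]

end EvalTwo

/-! ## §2 The dual comultiplication `δ = μ^*`: `ev (δ f) (x ⊗ y) = f (x * y)` -/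

section Comul

variable {R : Type u} [CommSemiring R] {B : Type v} [Semiring B] [Algebra R B]
variable {ev : WithConv (Module.Dual R B) ⊗[R] WithConv (Module.Dual R B) →ₗ[R] Module.Dual R (B ⊗[R] B)}

/-- **existence of the dual comultiplication** `μ^* : B^* → B^* ⊗ B^*` for a finite free algebra `B`: the transpose of the
multiplication `B ⊗ B → B` read in `B^* ⊗ B^* = (B ⊗ B)^*`. [cite: Tate1997FiniteFlatGroupSchemes, §(3.8) p. 145] -/
theorem exists_dualComul [Module.Free R B] [Module.Finite R B]
    (hev : ∀ (g h : WithConv (Module.Dual R B)) (x y : B), ev (g ⊗ₜ h) (x ⊗ₜ y) = g x * h y) :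
    ∃ δ : WithConv (Module.Dual R B) →ₗ[R] WithConv (Module.Dual R B) ⊗[R] WithConv (Module.Dual R B),
      ∀ (f : WithConv (Module.Dual R B)) (x y : B), ev (δ f) (x ⊗ₜ y) = f (x * y) := by
  let e := LinearEquiv.ofBijective ev (evalTwo_bijective hev)
  refine ⟨e.symm.toLinearMap ∘ₗ (LinearMap.mul' R B).dualMap ∘ₗ
    (WithConv.linearEquiv R (Module.Dual R B)).toLinearMap, fun f x y => ?_⟩
  have h1 : ev (e.symm ((LinearMap.mul' R B).dualMap (ofConv f))) = (LinearMap.mul' R B).dualMap (ofConv f) :=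
    LinearEquiv.apply_ofBijective_symm_apply ev (h := evalTwo_bijective hev) _
  change ev (e.symm ((LinearMap.mul' R B).dualMap (ofConv f))) (x ⊗ₜ y) = f (x * y)
  rw [h1, LinearMap.dualMap_apply, LinearMap.mul'_apply]

variable {δ : WithConv (Module.Dual R B) →ₗ[R] WithConv (Module.Dual R B) ⊗[R] WithConv (Module.Dual R B)}

/-- the dual comultiplication as a functional on `B ⊗ B`: `ev (δ f) = f ∘ μ`.
[cite: Tate1997FiniteFlatGroupSchemes, §(3.8) p. 145] -/
theorem evalTwo_dualComul
    (hδ : ∀ (f : WithConv (Module.Dual R B)) (x y : B), ev (δ f) (x ⊗ₜ y) = f (x * y))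
    (f : WithConv (Module.Dual R B)) : ev (δ f) = (ofConv f) ∘ₗ LinearMap.mul' R B :=
  TensorProduct.ext' fun x y => by rw [hδ, LinearMap.comp_apply, LinearMap.mul'_apply]

/-- **uniqueness of the dual comultiplication** (finite free `B`). [cite: Tate1997FiniteFlatGroupSchemes, §(3.8) p. 145] -/
theorem dualComul_unique [Module.Free R B] [Module.Finite R B]
    (hev : ∀ (g h : WithConv (Module.Dual R B)) (x y : B), ev (g ⊗ₜ h) (x ⊗ₜ y) = g x * h y)
    {δ' : WithConv (Module.Dual R B) →ₗ[R] WithConv (Module.Dual R B) ⊗[R] WithConv (Module.Dual R B)}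
    (hδ : ∀ (f : WithConv (Module.Dual R B)) (x y : B), ev (δ f) (x ⊗ₜ y) = f (x * y))
    (hδ' : ∀ (f : WithConv (Module.Dual R B)) (x y : B), ev (δ' f) (x ⊗ₜ y) = f (x * y)) : δ = δ' :=
  LinearMap.ext fun f => eq_of_evalTwo_eq hev fun x y => by rw [hδ, hδ']

end Comul

/-! ## §3 The triple evaluation `B^* ⊗ (B^* ⊗ B^*) → (B ⊗ (B ⊗ B))^*` and COASSOCIATIVITY of `μ^*` -/

section EvalThree

variable {R : Type u} [CommSemiring R] {B : Type v} [AddCommMonoid B] [Module R B]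
variable {ev : WithConv (Module.Dual R B) ⊗[R] WithConv (Module.Dual R B) →ₗ[R] Module.Dual R (B ⊗[R] B)}

variable (ev) in
/-- existence of the triple evaluation `ev₃ (g ⊗ t) (x ⊗ w) = g x * ev t w`.
[cite: Tate1997FiniteFlatGroupSchemes, §(3.8) p. 145] -/
theorem exists_evalThree :
    ∃ ev₃ : WithConv (Module.Dual R B) ⊗[R] (WithConv (Module.Dual R B) ⊗[R] WithConv (Module.Dual R B)) →ₗ[R]
        Module.Dual R (B ⊗[R] (B ⊗[R] B)),
      ∀ (g : WithConv (Module.Dual R B)) (t : WithConv (Module.Dual R B) ⊗[R] WithConv (Module.Dual R B))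
        (x : B) (w : B ⊗[R] B), ev₃ (g ⊗ₜ t) (x ⊗ₜ w) = g x * ev t w :=
  ⟨TensorProduct.dualDistrib R B (B ⊗[R] B) ∘ₗ
      TensorProduct.map (WithConv.linearEquiv R (Module.Dual R B)).toLinearMap ev,
    fun g t x w => by simp⟩

variable {ev₃ : WithConv (Module.Dual R B) ⊗[R] (WithConv (Module.Dual R B) ⊗[R] WithConv (Module.Dual R B)) →ₗ[R]
    Module.Dual R (B ⊗[R] (B ⊗[R] B))}

/-- the triple evaluation is unique. [cite: Tate1997FiniteFlatGroupSchemes, §(3.8) p. 145] -/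
theorem evalThree_unique
    {ev₃' : WithConv (Module.Dual R B) ⊗[R] (WithConv (Module.Dual R B) ⊗[R] WithConv (Module.Dual R B)) →ₗ[R]
      Module.Dual R (B ⊗[R] (B ⊗[R] B))}
    (hev₃ : ∀ (g : WithConv (Module.Dual R B)) (t : WithConv (Module.Dual R B) ⊗[R] WithConv (Module.Dual R B))
      (x : B) (w : B ⊗[R] B), ev₃ (g ⊗ₜ t) (x ⊗ₜ w) = g x * ev t w)
    (hev₃' : ∀ (g : WithConv (Module.Dual R B)) (t : WithConv (Module.Dual R B) ⊗[R] WithConv (Module.Dual R B))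
      (x : B) (w : B ⊗[R] B), ev₃' (g ⊗ₜ t) (x ⊗ₜ w) = g x * ev t w) : ev₃ = ev₃' :=
  TensorProduct.ext' fun g t => TensorProduct.ext' fun x w => by rw [hev₃, hev₃']

/-- **the triple evaluation is bijective when `B` is finite free** (`B^* ⊗ (B^* ⊗ B^*) = (B ⊗ (B ⊗ B))^*`).
[cite: Tate1997FiniteFlatGroupSchemes, §(3.8) p. 145] -/
theorem evalThree_bijective [Module.Free R B] [Module.Finite R B]
    (hev : ∀ (g h : WithConv (Module.Dual R B)) (x y : B), ev (g ⊗ₜ h) (x ⊗ₜ y) = g x * h y)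
    (hev₃ : ∀ (g : WithConv (Module.Dual R B)) (t : WithConv (Module.Dual R B) ⊗[R] WithConv (Module.Dual R B))
      (x : B) (w : B ⊗[R] B), ev₃ (g ⊗ₜ t) (x ⊗ₜ w) = g x * ev t w) :
    Function.Bijective ev₃ := by
  let e₂ := LinearEquiv.ofBijective ev (evalTwo_bijective hev)
  let e : WithConv (Module.Dual R B) ⊗[R] (WithConv (Module.Dual R B) ⊗[R] WithConv (Module.Dual R B)) ≃ₗ[R]
      Module.Dual R (B ⊗[R] (B ⊗[R] B)) :=
    (TensorProduct.congr (WithConv.linearEquiv R (Module.Dual R B)) e₂).trans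
      (TensorProduct.dualDistribEquiv R B (B ⊗[R] B))
  have he : ev₃ = e.toLinearMap := by
    refine evalThree_unique (ev := ev) hev₃ fun g t x w => ?_
    change TensorProduct.dualDistribEquiv R B (B ⊗[R] B)
      (TensorProduct.congr (WithConv.linearEquiv R (Module.Dual R B)) e₂ (g ⊗ₜ t)) (x ⊗ₜ w) = g x * ev t w
    rw [TensorProduct.congr_tmul]
    exact TensorProduct.dualDistrib_apply (ofConv g) (e₂ t) x w
  rw [he]
  exact e.bijective

/-- injectivity of the triple evaluation in test form (finite free `B`).
[cite: Tate1997FiniteFlatGroupSchemes, §(3.8) p. 145] -/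
theorem eq_of_evalThree_eq [Module.Free R B] [Module.Finite R B]
    (hev : ∀ (g h : WithConv (Module.Dual R B)) (x y : B), ev (g ⊗ₜ h) (x ⊗ₜ y) = g x * h y)
    (hev₃ : ∀ (g : WithConv (Module.Dual R B)) (t : WithConv (Module.Dual R B) ⊗[R] WithConv (Module.Dual R B))
      (x : B) (w : B ⊗[R] B), ev₃ (g ⊗ₜ t) (x ⊗ₜ w) = g x * ev t w)
    {s t : WithConv (Module.Dual R B) ⊗[R] (WithConv (Module.Dual R B) ⊗[R] WithConv (Module.Dual R B))}
    (h : ∀ x y z : B, ev₃ s (x ⊗ₜ (y ⊗ₜ z)) = ev₃ t (x ⊗ₜ (y ⊗ₜ z))) : s = t :=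
  (evalThree_bijective hev hev₃).1 (TensorProduct.ext_threefold' h)

/-- the triple evaluation of a re-associated pure tensor `(s ⊗ h) ↦ s ⊗ h`:
`ev₃ (assoc (s ⊗ h)) (x ⊗ (y ⊗ z)) = ev s (x ⊗ y) * h z`. [cite: Montgomery1993Hopf, 9.1.1] -/
theorem evalThree_assoc_tmul
    (hev : ∀ (g h : WithConv (Module.Dual R B)) (x y : B), ev (g ⊗ₜ h) (x ⊗ₜ y) = g x * h y)
    (hev₃ : ∀ (g : WithConv (Module.Dual R B)) (t : WithConv (Module.Dual R B) ⊗[R] WithConv (Module.Dual R B))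
      (x : B) (w : B ⊗[R] B), ev₃ (g ⊗ₜ t) (x ⊗ₜ w) = g x * ev t w)
    (s : WithConv (Module.Dual R B) ⊗[R] WithConv (Module.Dual R B)) (h : WithConv (Module.Dual R B)) (x y z : B) :
    ev₃ (TensorProduct.assoc R _ _ _ (s ⊗ₜ h)) (x ⊗ₜ (y ⊗ₜ z)) = ev s (x ⊗ₜ y) * h z := by
  induction s using TensorProduct.induction_on with
  | zero => simp
  | tmul g k => rw [TensorProduct.assoc_tmul, hev₃, hev, hev, mul_assoc]
  | add s t hs ht =>
    rw [TensorProduct.add_tmul, map_add, map_add, LinearMap.add_apply, hs, ht, map_add, LinearMap.add_apply, add_mul]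

end EvalThree

section Coassoc

variable {R : Type u} [CommSemiring R] {B : Type v} [Semiring B] [Algebra R B]
variable {ev : WithConv (Module.Dual R B) ⊗[R] WithConv (Module.Dual R B) →ₗ[R] Module.Dual R (B ⊗[R] B)}
variable {ev₃ : WithConv (Module.Dual R B) ⊗[R] (WithConv (Module.Dual R B) ⊗[R] WithConv (Module.Dual R B)) →ₗ[R]
    Module.Dual R (B ⊗[R] (B ⊗[R] B))}
variable {δ : WithConv (Module.Dual R B) →ₗ[R] WithConv (Module.Dual R B) ⊗[R] WithConv (Module.Dual R B)}

/-- `(id ⊗ μ^*)` under the triple evaluation: `ev₃ ((id ⊗ δ) t) (x ⊗ (y ⊗ z)) = ev t (x ⊗ y z)`.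
[cite: Montgomery1993Hopf, 9.1.1] -/
theorem evalThree_lTensor_dualComul
    (hev₃ : ∀ (g : WithConv (Module.Dual R B)) (t : WithConv (Module.Dual R B) ⊗[R] WithConv (Module.Dual R B))
      (x : B) (w : B ⊗[R] B), ev₃ (g ⊗ₜ t) (x ⊗ₜ w) = g x * ev t w)
    (hev : ∀ (g h : WithConv (Module.Dual R B)) (x y : B), ev (g ⊗ₜ h) (x ⊗ₜ y) = g x * h y)
    (hδ : ∀ (f : WithConv (Module.Dual R B)) (x y : B), ev (δ f) (x ⊗ₜ y) = f (x * y))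
    (t : WithConv (Module.Dual R B) ⊗[R] WithConv (Module.Dual R B)) (x y z : B) :
    ev₃ (δ.lTensor _ t) (x ⊗ₜ (y ⊗ₜ z)) = ev t (x ⊗ₜ (y * z)) := by
  induction t using TensorProduct.induction_on with
  | zero => simp
  | tmul g h => rw [LinearMap.lTensor_tmul, hev₃, hδ, hev]
  | add s t hs ht => rw [map_add, map_add, LinearMap.add_apply, hs, ht, map_add, LinearMap.add_apply]

/-- `(μ^* ⊗ id)` under the triple evaluation: `ev₃ (assoc ((δ ⊗ id) t)) (x ⊗ (y ⊗ z)) = ev t (x y ⊗ z)`.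
[cite: Montgomery1993Hopf, 9.1.1] -/
theorem evalThree_assoc_rTensor_dualComul
    (hev₃ : ∀ (g : WithConv (Module.Dual R B)) (t : WithConv (Module.Dual R B) ⊗[R] WithConv (Module.Dual R B))
      (x : B) (w : B ⊗[R] B), ev₃ (g ⊗ₜ t) (x ⊗ₜ w) = g x * ev t w)
    (hev : ∀ (g h : WithConv (Module.Dual R B)) (x y : B), ev (g ⊗ₜ h) (x ⊗ₜ y) = g x * h y)
    (hδ : ∀ (f : WithConv (Module.Dual R B)) (x y : B), ev (δ f) (x ⊗ₜ y) = f (x * y))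
    (t : WithConv (Module.Dual R B) ⊗[R] WithConv (Module.Dual R B)) (x y z : B) :
    ev₃ (TensorProduct.assoc R _ _ _ (δ.rTensor _ t)) (x ⊗ₜ (y ⊗ₜ z)) = ev t ((x * y) ⊗ₜ z) := by
  induction t using TensorProduct.induction_on with
  | zero => simp
  | tmul g h => rw [LinearMap.rTensor_tmul, evalThree_assoc_tmul hev hev₃, hδ, hev]
  | add s t hs ht => rw [map_add, map_add, map_add, LinearMap.add_apply, hs, ht, map_add, LinearMap.add_apply]

/-- **COASSOCIATIVITY of the dual comultiplication** `μ^*` of a finite free algebra — Mathlib's `Coalgebra.coassoc` field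
verbatim on the carrier `WithConv (Module.Dual R B)`: `assoc ∘ (δ ⊗ id) ∘ δ = (id ⊗ δ) ∘ δ` (it is the transpose of the
associativity of `B`). [cite: Tate1997FiniteFlatGroupSchemes, §(3.8) p. 145] -/
theorem dualComul_coassoc [Module.Free R B] [Module.Finite R B]
    (hev : ∀ (g h : WithConv (Module.Dual R B)) (x y : B), ev (g ⊗ₜ h) (x ⊗ₜ y) = g x * h y)
    (hδ : ∀ (f : WithConv (Module.Dual R B)) (x y : B), ev (δ f) (x ⊗ₜ y) = f (x * y)) :
    TensorProduct.assoc R (WithConv (Module.Dual R B)) (WithConv (Module.Dual R B)) (WithConv (Module.Dual R B)) ∘ₗ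
        δ.rTensor (WithConv (Module.Dual R B)) ∘ₗ δ =
      δ.lTensor (WithConv (Module.Dual R B)) ∘ₗ δ := by
  obtain ⟨ev₃, hev₃⟩ := exists_evalThree ev
  refine LinearMap.ext fun f => eq_of_evalThree_eq hev hev₃ fun x y z => ?_
  change ev₃ (TensorProduct.assoc R _ _ _ (δ.rTensor _ (δ f))) (x ⊗ₜ (y ⊗ₜ z)) =
    ev₃ (δ.lTensor _ (δ f)) (x ⊗ₜ (y ⊗ₜ z))
  rw [evalThree_assoc_rTensor_dualComul hev₃ hev hδ, evalThree_lTensor_dualComul hev₃ hev hδ, hδ, hδ, mul_assoc]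

end Coassoc

/-! ## §4 The dual counit `ε f = f 1` and the two COUNIT LAWS -/

section Counit

variable {R : Type u} [CommSemiring R] {B : Type v} [Semiring B] [Algebra R B]
variable {ev : WithConv (Module.Dual R B) ⊗[R] WithConv (Module.Dual R B) →ₗ[R] Module.Dual R (B ⊗[R] B)}
variable {δ : WithConv (Module.Dual R B) →ₗ[R] WithConv (Module.Dual R B) ⊗[R] WithConv (Module.Dual R B)}
variable {ε : WithConv (Module.Dual R B) →ₗ[R] R}

variable (R B) in
/-- existence of the dual counit `ε f = f 1` (the transpose of the unit `R → B`).
[cite: Tate1997FiniteFlatGroupSchemes, §(3.8) p. 145] -/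
theorem exists_dualCounit :
    ∃ ε : WithConv (Module.Dual R B) →ₗ[R] R, ∀ f : WithConv (Module.Dual R B), ε f = f 1 :=
  ⟨LinearMap.applyₗ (1 : B) ∘ₗ (WithConv.linearEquiv R (Module.Dual R B)).toLinearMap, fun _ => rfl⟩

/-- the dual counit is unique. [cite: Tate1997FiniteFlatGroupSchemes, §(3.8) p. 145] -/
theorem dualCounit_unique {ε' : WithConv (Module.Dual R B) →ₗ[R] R}
    (hε : ∀ f : WithConv (Module.Dual R B), ε f = f 1) (hε' : ∀ f : WithConv (Module.Dual R B), ε' f = f 1) :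
    ε = ε' :=
  LinearMap.ext fun f => by rw [hε, hε']

/-- `(ε ⊗ id)` read in `R ⊗ B^* = B^*`: `lid ((ε ⊗ id) t) y = ev t (1 ⊗ y)`. [cite: Montgomery1993Hopf, 9.1.1] -/
theorem lid_rTensor_dualCounit
    (hev : ∀ (g h : WithConv (Module.Dual R B)) (x y : B), ev (g ⊗ₜ h) (x ⊗ₜ y) = g x * h y)
    (hε : ∀ f : WithConv (Module.Dual R B), ε f = f 1)
    (t : WithConv (Module.Dual R B) ⊗[R] WithConv (Module.Dual R B)) (y : B) :
    (TensorProduct.lid R (WithConv (Module.Dual R B)) (ε.rTensor _ t)) y = ev t (1 ⊗ₜ y) := by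
  induction t using TensorProduct.induction_on with
  | zero => simp
  | tmul g h =>
    rw [LinearMap.rTensor_tmul, TensorProduct.lid_tmul, hev, hε]
    simp only [WithConv.ofConv_smul, LinearMap.smul_apply, smul_eq_mul]
  | add s t hs ht =>
    rw [map_add, map_add, map_add, LinearMap.add_apply, ← hs, ← ht]
    simp only [WithConv.ofConv_add, LinearMap.add_apply]

/-- `(id ⊗ ε)` read in `B^* ⊗ R = B^*`: `rid ((id ⊗ ε) t) x = ev t (x ⊗ 1)`. [cite: Montgomery1993Hopf, 9.1.1] -/
theorem rid_lTensor_dualCounit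
    (hev : ∀ (g h : WithConv (Module.Dual R B)) (x y : B), ev (g ⊗ₜ h) (x ⊗ₜ y) = g x * h y)
    (hε : ∀ f : WithConv (Module.Dual R B), ε f = f 1)
    (t : WithConv (Module.Dual R B) ⊗[R] WithConv (Module.Dual R B)) (x : B) :
    (TensorProduct.rid R (WithConv (Module.Dual R B)) (ε.lTensor _ t)) x = ev t (x ⊗ₜ 1) := by
  induction t using TensorProduct.induction_on with
  | zero => simp
  | tmul g h =>
    rw [LinearMap.lTensor_tmul, TensorProduct.rid_tmul, hev, hε]
    simp only [WithConv.ofConv_smul, LinearMap.smul_apply, smul_eq_mul, mul_comm (g x)]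
  | add s t hs ht =>
    rw [map_add, map_add, map_add, LinearMap.add_apply, ← hs, ← ht]
    simp only [WithConv.ofConv_add, LinearMap.add_apply]

/-- **left counit law of the dual coalgebra** — Mathlib's `Coalgebra.rTensor_counit_comp_comul` field verbatim on the
carrier `WithConv (Module.Dual R B)`: `(ε ⊗ id) ∘ δ = (1 ⊗ ·)`. [cite: Tate1997FiniteFlatGroupSchemes, §(3.8) p. 145] -/
theorem rTensor_dualCounit_comp_dualComul
    (hev : ∀ (g h : WithConv (Module.Dual R B)) (x y : B), ev (g ⊗ₜ h) (x ⊗ₜ y) = g x * h y)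
    (hδ : ∀ (f : WithConv (Module.Dual R B)) (x y : B), ev (δ f) (x ⊗ₜ y) = f (x * y))
    (hε : ∀ f : WithConv (Module.Dual R B), ε f = f 1) :
    ε.rTensor (WithConv (Module.Dual R B)) ∘ₗ δ = TensorProduct.mk R R (WithConv (Module.Dual R B)) 1 := by
  refine LinearMap.ext fun f => (TensorProduct.lid R (WithConv (Module.Dual R B))).injective ?_
  refine WithConv.ext (LinearMap.ext fun y => ?_)
  change (TensorProduct.lid R _ (ε.rTensor _ (δ f))) y = (TensorProduct.lid R _ ((1 : R) ⊗ₜ f)) y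
  rw [lid_rTensor_dualCounit hev hε, hδ, one_mul, TensorProduct.lid_tmul, one_smul]

/-- **right counit law of the dual coalgebra** — Mathlib's `Coalgebra.lTensor_counit_comp_comul` field verbatim on the
carrier `WithConv (Module.Dual R B)`: `(id ⊗ ε) ∘ δ = (· ⊗ 1)`. [cite: Tate1997FiniteFlatGroupSchemes, §(3.8) p. 145] -/
theorem lTensor_dualCounit_comp_dualComul
    (hev : ∀ (g h : WithConv (Module.Dual R B)) (x y : B), ev (g ⊗ₜ h) (x ⊗ₜ y) = g x * h y)
    (hδ : ∀ (f : WithConv (Module.Dual R B)) (x y : B), ev (δ f) (x ⊗ₜ y) = f (x * y))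
    (hε : ∀ f : WithConv (Module.Dual R B), ε f = f 1) :
    ε.lTensor (WithConv (Module.Dual R B)) ∘ₗ δ = (TensorProduct.mk R (WithConv (Module.Dual R B)) R).flip 1 := by
  refine LinearMap.ext fun f => (TensorProduct.rid R (WithConv (Module.Dual R B))).injective ?_
  refine WithConv.ext (LinearMap.ext fun x => ?_)
  change (TensorProduct.rid R _ (ε.lTensor _ (δ f))) x = (TensorProduct.rid R _ (f ⊗ₜ (1 : R))) x
  rw [rid_lTensor_dualCounit hev hε, hδ, mul_one, TensorProduct.rid_tmul, one_smul]

end Counit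

/-! ## §5 COCOMMUTATIVITY of `μ^*` for a commutative algebra -/

section Cocomm

variable {R : Type u} [CommSemiring R] {B : Type v} [CommSemiring B] [Algebra R B]
variable {ev : WithConv (Module.Dual R B) ⊗[R] WithConv (Module.Dual R B) →ₗ[R] Module.Dual R (B ⊗[R] B)}
variable {δ : WithConv (Module.Dual R B) →ₗ[R] WithConv (Module.Dual R B) ⊗[R] WithConv (Module.Dual R B)}

/-- **the dual of a commutative finite free algebra is cocommutative** — Mathlib's `Coalgebra.IsCocomm.comm_comp_comul`
field on the carrier `WithConv (Module.Dual R B)`: `comm ∘ δ = δ`. [cite: Tate1997FiniteFlatGroupSchemes, §(3.8) p. 145] -/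
theorem comm_comp_dualComul [Module.Free R B] [Module.Finite R B]
    (hev : ∀ (g h : WithConv (Module.Dual R B)) (x y : B), ev (g ⊗ₜ h) (x ⊗ₜ y) = g x * h y)
    (hδ : ∀ (f : WithConv (Module.Dual R B)) (x y : B), ev (δ f) (x ⊗ₜ y) = f (x * y)) :
    (TensorProduct.comm R (WithConv (Module.Dual R B)) (WithConv (Module.Dual R B))).toLinearMap ∘ₗ δ = δ := by
  refine LinearMap.ext fun f => eq_of_evalTwo_eq hev fun x y => ?_
  change ev (TensorProduct.comm R _ _ (δ f)) (x ⊗ₜ y) = ev (δ f) (x ⊗ₜ y)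
  rw [evalTwo_comm hev, hδ, hδ, mul_comm]

end Cocomm

end Literature.RingTheory.HopfAlgebra

end
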